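import Literature.Computability.AlgebraicComplexity.FormChartDimensionCount
import Literature.Computability.AlgebraicComplexity.StabilizerEigenbasisCharts
import Literature.Computability.AlgebraicComplexity.InvariantMonomialCount
import Literature.Computability.AlgebraicComplexity.BI17FiniteStabilizerLocusProofs
import Literature.Computability.AlgebraicComplexity.Poonen05HypersurfaceLinearAutomorphisms
import Literature.Computability.AlgebraicComplexity.GenericFormsNonsingular
import HarnessLib

/-!
# Almost all forms have a trivial stabilizer (Matsumura–Monsky; BI 2017 §2.1) — proofs

Bürgisser–Ikenmeyer 2017 §2.1 (arXiv:1511.02927, TeX L466–468): "Matsumura and Monsky showed that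
if `D > 2` and `m > 3`, then almost all `w ∈ Sym^D ℂ^m` have a trivial stabilizer" — the tree's
fact `BI2017_matsumuraMonsky_trivialStabilizer` (`BI17FundamentalInvariantForms.lean`), DISCHARGED
here: `BI2017_matsumuraMonsky_trivialStabilizer_holds`. The main theorem
`isZariskiGeneric_hasTrivialStabilizer` covers `D ≥ 3`, `m ≥ 3`, `(D,m) ≠ (3,3)` — exactly the
range of Poonen 2005 Thm. 3 in BI's stabilizer language (the conclusion of the tree's CONDITIONAL
bridge `poonen2005_thm_3.isZariskiGeneric_hasTrivialStabilizer`, now unconditional over `ℂ`; the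
typed fact `poonen2005_thm_3` itself — all algebraically closed fields, with nonsingularity — is NOT
discharged here).

## Proof (ours; elementary — no dimension theory, no openness of the trivial-stabilizer locus)

Route ≠ the printed proofs ([MM] dimension of incidence varieties; Katz–Sarnak 11.8.5 / Poonen
Thm. 4). For a form `w` of degree `D`:
1. generic FINITENESS of `stab(w)` is in the tree (`isZariskiGeneric_finite_linStabilizer`,
   BI Thm. 2.3 first sentence, t13's Lie-algebra criterion), so every `γ ∈ stab(w)` has finite
   order and is diagonalisable, `γ = P diag(c) P⁻¹`;
2. (`StabilizerEigenbasisCharts`) either `c` is constant — then `γ = ζ·1` with `ζ^D = 1` — or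
   `w = g · v` with `v` supported on the `diag(c)`-invariant monomials `S_c` and `g` in the pivot
   chart of the eigenvalue blocks, an affine family with `F(c) = #{(i,j) : c_i ≠ c_j}` parameters;
3. (`InvariantMonomialCount`) `#S_c + F(c) < N = #{monomials of degree D}` whenever
   `D ≥ 3`, `m ≥ 3`, `(D,m) ≠ (3,3)`;
4. (`FormChartDimensionCount`) hence a nonzero polynomial in the `N` coefficients vanishes on each
   such chart image; there are finitely many charts (indexed by block/pivot data and supports), so
   the product of these polynomials with the finiteness polynomial is a nonzero polynomial off whose
   zero set every stabilizer element is scalar.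

Honest framing: a classical theorem (Matsumura–Monsky 1964) re-proved by counting; typed ≠
endorsed; nothing here bears on VP versus VNP.
[cite: BurgisserIkenmeyer2017, §2.1 ("almost all w ∈ Sym^D ℂ^m have a trivial stabilizer")]

## References

* P. Bürgisser, C. Ikenmeyer, *Fundamental invariants of orbit closures*, J. Algebra 477 (2017),
  §2.1, TeX L466–468. [BurgisserIkenmeyer2017]
* H. Matsumura, P. Monsky, *On the automorphisms of hypersurfaces*, J. Math. Kyoto Univ. 3
  (1963/64) 347–361, Thm. 1–2 (not held, acq-11400). [MatsumuraMonsky1963]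
* B. Poonen, *Varieties without extra automorphisms III: hypersurfaces*, Finite Fields Appl. 11
  (2005), Thm. 3. [Poonen2005]
-/

noncomputable section

open MvPolynomial
open Literature.AlgebraicGeometry.Motives.SmoothHypersurface (IsNonsingularForm)

namespace Literature.Computability.AlgebraicComplexity

section Assembly

variable {m D : ℕ}

/-- Generic forms are nonzero (`m ≥ 1`; test polynomial: the coordinate of `x_0^D`) — local copy
of the tree's `isZariskiGeneric_ne_zero`. [folklore] -/
private theorem isZariskiGeneric_ne_zero_aux (hm : 0 < m) (D : ℕ) :
    IsZariskiGeneric D fun f : MvPolynomial (Fin m) ℂ => f ≠ 0 := by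
  have hd : Finsupp.single (⟨0, hm⟩ : Fin m) D ∈ degMonomials (Fin m) D := by
    rw [mem_degMonomials_iff, Finsupp.degree_single]
  refine ⟨X ⟨_, hd⟩, X_ne_zero _, fun f _ hF => ?_⟩
  rintro rfl
  rw [aeval_X, formCoeff_apply, coeff_zero] at hF
  exact hF rfl

/-- A property true of all forms is Zariski-generic. [folklore] -/
private theorem isZariskiGeneric_of_forall_aux {P : MvPolynomial (Fin m) ℂ → Prop}
    (h : ∀ f, P f) : IsZariskiGeneric D P :=
  ⟨1, one_ne_zero, fun f _ _ => h f⟩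

/-- **Almost all forms of degree `D ≥ 3` in `m ≥ 3` variables, `(D,m) ≠ (3,3)`, have a trivial
stabilizer** `stab(w) = μ_D · 1` (Matsumura–Monsky; BI 2017 §2.1 L466–468 for `m > 3`; Poonen 2005
Thm. 3 for the range including plane curves of degree `≥ 4`), over `ℂ`.
[cite: BurgisserIkenmeyer2017, §2.1 ("almost all w ∈ Sym^D ℂ^m have a trivial stabilizer")] -/
theorem isZariskiGeneric_hasTrivialStabilizer (hD : 3 ≤ D) (hm : 3 ≤ m) (h33 : D = 3 → 4 ≤ m) :
    IsZariskiGeneric D (HasTrivialStabilizer D : MvPolynomial (Fin m) ℂ → Prop) := by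
  classical
  -- (1) generic finiteness and non-vanishing
  obtain ⟨F₁, hF₁0, hF₁⟩ := isZariskiGeneric_finite_linStabilizer (D := D) (m := m) (by omega) (by omega)
  obtain ⟨F₀, hF₀0, hF₀⟩ := isZariskiGeneric_ne_zero_aux (m := m) (by omega) D
  -- (4) generic avoidance of every small eigen-chart
  -- charts are indexed by (block labels, pivot rows, support ⊆ degree-`D` monomials)
  have hchart : ∀ a : (Fin m → Fin m) × (Fin m → Fin m) × ↥((degMonomials (Fin m) D).powerset),
      IsZariskiGeneric D fun f : MvPolynomial (Fin m) ℂ =>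
      Fintype.card (chartVars a.1 a.2.1) + a.2.2.1.card < (degMonomials (Fin m) D).card →
        f ∉ chartImage (chartMatrix ℂ a.1 a.2.1) a.2.2.1 := by
    intro a
    by_cases hlt : Fintype.card (chartVars a.1 a.2.1) + a.2.2.1.card < (degMonomials (Fin m) D).card
    · obtain ⟨F, hF0, hF⟩ := isZariskiGeneric_not_mem_chartImage D (chartMatrix ℂ a.1 a.2.1)
        a.2.2.1 hlt
      exact ⟨F, hF0, fun f hf hFf _ => hF f hf hFf⟩
    · exact isZariskiGeneric_of_forall_aux fun f h => absurd h hlt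
  obtain ⟨F₂, hF₂0, hF₂⟩ := IsZariskiGeneric.forall_fintype hchart
  refine ⟨F₀ * F₁ * F₂, mul_ne_zero (mul_ne_zero hF₀0 hF₁0) hF₂0, fun f hf hFf => ?_⟩
  rw [map_mul, map_mul] at hFf
  have hf0 : f ≠ 0 := hF₀ f hf (left_ne_zero_of_mul (left_ne_zero_of_mul hFf))
  have hfin : Finite (linStabilizer f) := hF₁ f hf (right_ne_zero_of_mul (left_ne_zero_of_mul hFf))
  have havoid := hF₂ f hf (right_ne_zero_of_mul hFf)
  -- (2) a stabilizer element has finite order; take its eigen-chart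
  intro γ hγ
  have hfo : IsOfFinOrder (⟨γ, hγ⟩ : linStabilizer f) := isOfFinOrder_of_finite _
  set n := orderOf (⟨γ, hγ⟩ : linStabilizer f) with hn
  have hn0 : 0 < n := hfo.orderOf_pos
  have hγn : ((γ : GL (Fin m) ℂ) : Matrix (Fin m) (Fin m) ℂ) ^ n = 1 := by
    have h := pow_orderOf_eq_one (⟨γ, hγ⟩ : linStabilizer f)
    rw [← hn, Subtype.ext_iff, Subgroup.coe_pow, Subgroup.coe_one] at h
    rw [← Units.val_pow_eq_pow_val, h, Units.val_one]
  have hstab : linSubst (Fin m) ℂ (γ : Matrix (Fin m) (Fin m) ℂ) f = f := by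
    rw [← linSubstRep_apply]; exact mem_linStabilizer.mp hγ
  obtain ⟨c, hc0, hscalar, ρ, hρ, p, v, hvhom, hvsupp, hfv⟩ :=
    exists_eigenChart_of_pow_eq_one hf hn0 hγn hstab
  by_cases hconst : ∃ i j, c i ≠ c j
  · -- non-scalar: the form lies in a small chart, contradiction with (4) via (3)
    exfalso
    have hS : invMonomials D c ⊆ degMonomials (Fin m) D := invMonomials_subset D c
    have hlt : Fintype.card (chartVars (blkOf c) ρ) + (invMonomials D c).card <
        (degMonomials (Fin m) D).card := by
      rw [card_chartVars hρ]
      have hfilt : (Finset.univ.filter fun q : Fin m × Fin m => blkOf c q.1 ≠ blkOf c q.2) =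
          Finset.univ.filter fun q : Fin m × Fin m => c q.1 ≠ c q.2 :=
        Finset.filter_congr fun q _ => not_congr (blkOf_eq_blkOf_iff c q.1 q.2)
      rw [hfilt, add_comm]
      have h := card_invariant_add_card_cross_lt c hc0 hD hm h33 hconst
      convert h using 2
      congr 1
    exact havoid ⟨blkOf c, ρ, ⟨invMonomials D c, Finset.mem_powerset.mpr hS⟩⟩ hlt
      (hfv ▸ linSubst_mem_chartImage _ p hvsupp)
  · -- scalar: `γ = ζ · 1` with `ζ^D = 1`
    have hall : ∀ i j, c i = c j := fun i j => by
      by_contra h; exact hconst ⟨i, j, h⟩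
    have i₀ : Fin m := ⟨0, by omega⟩
    have hγeq : ((γ : GL (Fin m) ℂ) : Matrix (Fin m) (Fin m) ℂ) = c i₀ • (1 : Matrix _ _ ℂ) :=
      hscalar i₀ fun i => hall i i₀
    exact ⟨c i₀, pow_eq_one_of_smul_one_mem_linStabilizer hf hf0 hγ hγeq, hγeq⟩

/-- **BI 2017 §2.1 (Matsumura–Monsky 1963, as quoted, TeX L466–468) — DISCHARGED**: "if `D > 2` and
`m > 3`, then almost all `w ∈ Sym^D ℂ^m` have a trivial stabilizer."
[cite: BurgisserIkenmeyer2017, §2.1 ("almost all w ∈ Sym^D ℂ^m have a trivial stabilizer")] -/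
theorem BI2017_matsumuraMonsky_trivialStabilizer_holds : BI2017_matsumuraMonsky_trivialStabilizer :=
  fun _ _ hD hm => isZariskiGeneric_hasTrivialStabilizer (by omega) (by omega) (by omega)

/-- **Almost all plane curves of degree `d ≥ 4` have a trivial stabilizer** (`m = 3`): the
stabilizer-level form of Poonen 2005 Thm. 3 at `n = 1` over `ℂ`, strengthening the tree's
`isZariskiGeneric_ternaryQuartic_period` (`det(stab) = μ₄` for generic plane quartics) to
`stab = μ₄ · 1`. [cite: Poonen2005, Thm. 3] -/
theorem isZariskiGeneric_hasTrivialStabilizer_ternary (hD : 4 ≤ D) :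
    IsZariskiGeneric D (HasTrivialStabilizer D : MvPolynomial (Fin 3) ℂ → Prop) :=
  isZariskiGeneric_hasTrivialStabilizer (by omega) le_rfl (by omega)

/-! ### Generic stabilizer periods (BI 2017 Thm. 2.3, as corrected, in the range `m ≥ 3`) -/

/-- **Generic periods `a(D,m) = D / gcd(D,m)` and `a'(D,m) = 1`** for `D ≥ 3`, `m ≥ 3`,
`(D,m) ≠ (3,3)` (BI 2017 §2.1 L466–468: a trivial stabilizer "implies `a'(D,m) = 1`"; Thm. 2.3
second sentence AS CORRECTED by erratum A21 in this range — the printed exception `a'(4,3) = 2`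
is not one). Unconditional form of the tree's `poonen2005_thm_3.isZariskiGeneric_reducedStabilizerPeriod_eq_one`.
[cite: BurgisserIkenmeyer2017, Thm. 2.3] -/
theorem isZariskiGeneric_stabilizerPeriod_eq_div_gcd (hD : 3 ≤ D) (hm : 3 ≤ m)
    (h33 : D = 3 → 4 ≤ m) :
    IsZariskiGeneric D fun f : MvPolynomial (Fin m) ℂ =>
      stabilizerPeriod f = D / Nat.gcd D m ∧ reducedStabilizerPeriod D f = 1 := by
  obtain ⟨F, hF0, hF⟩ := isZariskiGeneric_hasTrivialStabilizer (D := D) (m := m) hD hm h33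
  exact ⟨F, hF0, fun f hf hFf =>
    ⟨stabilizerPeriod_eq_of_hasTrivialStabilizer hf (by omega) (hF f hf hFf),
      reducedStabilizerPeriod_eq_one_of_hasTrivialStabilizer hf (by omega) (hF f hf hFf)⟩⟩

/-- **BI 2017 Thm. 2.3, second sentence, the range `m ≥ 4`** (all `D > 2`): "`a'(D,m) = 1`"
generically — PROVED (no printed exception has `m ≥ 4`). [cite: BurgisserIkenmeyer2017, Thm. 2.3] -/
theorem BI2017_thm_2_3_period_of_four_le (hD : 2 < D) (hm : 4 ≤ m) :
    IsZariskiGeneric D fun f : MvPolynomial (Fin m) ℂ => reducedStabilizerPeriod D f = 1 := by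
  obtain ⟨F, hF0, hF⟩ := isZariskiGeneric_stabilizerPeriod_eq_div_gcd (D := D) (m := m)
    (by omega) (by omega) (fun _ => hm)
  exact ⟨F, hF0, fun f hf hFf => (hF f hf hFf).2⟩

/-- **BI 2017 Thm. 2.3, second sentence, ternary forms of degree `D ≥ 4`**: "`a'(D,3) = 1`"
generically — PROVED; for `D = 4` this is the CORRECTED value (erratum A21; cf. the tree's
`isZariskiGeneric_ternaryQuartic_reducedStabilizerPeriod_eq_one`, another proof via Cayley's
invariant). [cite: BurgisserIkenmeyer2017, Thm. 2.3] -/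
theorem BI2017_thm_2_3_period_ternary_of_four_le (hD : 4 ≤ D) :
    IsZariskiGeneric D fun f : MvPolynomial (Fin 3) ℂ => reducedStabilizerPeriod D f = 1 := by
  obtain ⟨F, hF0, hF⟩ := isZariskiGeneric_stabilizerPeriod_eq_div_gcd (D := D) (m := 3)
    (by omega) le_rfl (by omega)
  exact ⟨F, hF0, fun f hf hFf => (hF f hf hFf).2⟩

/-- **BI 2017 App. Prop. 7.5 (3)** (the third conjunct of the tree's `BI2017_prop_A_5`, whose
second conjunct is refuted as printed): "Let `D ≥ 5`. The stabilizer of a generic `w ∈ Sym^D ℂ³` is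
trivial, hence `a'(D,3) = 1`" — PROVED (indeed for `D ≥ 4`).
[cite: BurgisserIkenmeyer2017, §7 (Appendix) Prop. 7.5] -/
theorem BI2017_prop_A_5_part3 (D : ℕ) (hD : 5 ≤ D) :
    IsZariskiGeneric D fun f : MvPolynomial (Fin 3) ℂ =>
      HasTrivialStabilizer D f ∧ reducedStabilizerPeriod D f = 1 := by
  obtain ⟨F, hF0, hF⟩ := isZariskiGeneric_hasTrivialStabilizer (D := D) (m := 3)
    (by omega) le_rfl (by omega)
  exact ⟨F, hF0, fun f hf hFf => ⟨hF f hf hFf,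
    reducedStabilizerPeriod_eq_one_of_hasTrivialStabilizer hf (by omega) (hF f hf hFf)⟩⟩

/-! ### Poonen 2005 Thm. 3 over `ℂ` -/

/-- **Poonen 2005, Thm. 3 — the `K = ℂ` instance, PROVED** (the statement of the tree's fact
`poonen2005_thm_3` at `K := ℂ`, verbatim): for `n ≥ 1`, `d ≥ 3`, `(n,d) ≠ (1,3)`, the generic
hypersurface of degree `d` in `ℙ^{n+1}_ℂ` is smooth and has `Lin X = {1}`. Smoothness: the tree's
`isZariskiGeneric_isNonsingularForm` (point form + Nullstellensatz); `Lin X = {1}`: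
`isZariskiGeneric_hasTrivialStabilizer` and the dictionary `hasTrivialLinAut_iff_hasTrivialStabilizer`.
The fact itself (every algebraically closed field, any characteristic) is NOT discharged here.
[cite: Poonen2005, Thm. 3] -/
theorem poonen2005_thm_3_complex :
    ∀ (n d : ℕ), 1 ≤ n → 3 ≤ d → (n, d) ≠ (1, 3) →
      IsZariskiGeneric d fun f : MvPolynomial (Fin (n + 2)) ℂ =>
        IsNonsingularForm ℂ f ∧ HasTrivialLinAut f := by
  intro n d hn hd hnd
  have h33 : d = 3 → 4 ≤ n + 2 := by
    intro h3
    by_contra hlt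
    exact hnd (Prod.ext (by simp only; omega) h3)
  obtain ⟨F₁, hF₁0, hF₁⟩ := isZariskiGeneric_isNonsingularForm (n := n) (D := d) (by omega)
  obtain ⟨F₂, hF₂0, hF₂⟩ :=
    isZariskiGeneric_hasTrivialStabilizer (D := d) (m := n + 2) hd (by omega) h33
  refine ⟨F₁ * F₂, mul_ne_zero hF₁0 hF₂0, fun f hf hFf => ?_⟩
  rw [map_mul] at hFf
  have hns : IsNonsingularForm ℂ f := hF₁ f hf (left_ne_zero_of_mul hFf)
  exact ⟨hns, (hasTrivialLinAut_iff_hasTrivialStabilizer hf (by omega)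
    (ne_zero_of_isNonsingularForm hns)).mpr (hF₂ f hf (right_ne_zero_of_mul hFf))⟩

end Assembly

end Literature.Computability.AlgebraicComplexity
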